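import Summits.BirchSwinnertonDyer.Rank1Residual.X11a.PrintHidaMembersRoad
import HarnessLib

/-!
# Route `PrintX11a`, crux `X11aLowerHalf` (item stmt-BirchSwinnertonDyer-19064): road p1's instance of
# the lower half on the SURJECTIVE sub-leaf `ClassX11a ∧ 5 ≤ p ∧ Surj`, BY NAME, and the crux
# assembled from its three sub-leaves (cell `bsd-print-x11a`, seat p1; `--supports 19064`)

HONEST FRAMING. THEOREMS ONLY (no definition, no named fact, no `sorry`); the item is NOT closed by
this file; the lower half `Typed.MissingLowerBoundAt W p` (`ord_p #Ш_an ≤ ord_p #Ш`) at a surjective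
X11a pair is delivered CONDITIONALLY on road p1's typed open input at that pair —
`X11a.EisensteinHalfAt W p` (the one-factor Eisenstein half of Mazur's main conjecture at `p ‖ N`,
`Rank1Residual/X11a/PrintEisensteinHalf.lean`) or, one step upstream, the Hida-members transfer datum
`X11a.HidaMembersTransferAt W p` (Skinner 2016 §3.1 read one-sidedly,
`Rank1Residual/X11a/PrintHidaMembersTransfer.lean`; on this sub-leaf the two are equivalent to each
other and to `X2.MazurMainConjectureAt W p`, referee R0-8 / `eisensteinHalfAt_iff_mazurMainConjectureAt`)
— whose beyond-print content is the integral cyclotomic Eisenstein divisibility at the good-ordinary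
higher-weight Hida members WITHOUT (mult) («beyond-print theorem: this file NO; a closure on road p1:
YES»). PUBLISHED named facts used: Kato–Wuthrich A32 (`kato_charIdeal_dvd_multiplicative_of_surjective`),
Stein–Wuthrich 2013 Thm. 6.1 ×2, Greenberg–Stevens, Gross–Zagier–Kolyvagin, modularity
(`exists_isNewformOf`). No label moves; X11a stays CONSTRUCTION-SHAPED.

WHAT (planner PLAN.md v1 §2, p1's deliverable «`EisensteinHalfAt W p → MissingLowerBoundAt W p` on
ClassX11a ∧ Surj ∧ 5 ≤ p BY NAME (--supports 19064)»):
* `x11aLowerHalf_onSurjFive_of_forall_eisensteinHalfAt` — the sub-leaf statement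
  `∀ W p, ClassX11a W p → 5 ≤ p → Surj W p → Typed.MissingLowerBoundAt W p` from the Eisenstein half
  at every such pair (`X11a.missingLowerBoundAt_of_eisensteinHalf`);
* `x11aLowerHalf_onSurjFive_of_forall_hidaMembersTransferAt` — the same from the transfer datum
  (`X11a.missingLowerBoundAt_of_hidaMembersTransferAt`);
* `x11aLowerHalf_of_subleaves` — the crux's statement VERBATIM (the body of
  `Summit.BirchSwinnertonDyer.BirchSwinnertonDyer.Theses.PrintX11a.X11aLowerHalf` =
  `Theses.ErratumRoadFive.X11aLowerHalf`, spelled out so that this helper does not import the route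
  file; the by-name form is `Iff.rfl` away), from its three
  sub-leaf statements (`5 ≤ p ∧ Surj` — roads p1/p2/p4; `p = 3` — `CellThree`, x11b/x11c's domain,
  flag `SU14-12.3.6-mu@nonsplit@3`; `5 ≤ p ∧ ¬ Surj` — rung K6), pure logic on `p ≠ 2`;
* `x11aLowerHalf_of_forall_eisensteinHalfAt_of_three_of_nonSurj` — hence the crux's statement from
  road p1's input on the surjective sub-leaf plus the two other sub-leaf statements.

References: [Skinner2016PacificMC] §3.1–3.3; [Wuthrich2014] Thm. 3, Cor. 19; [SteinWuthrich2013]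
Thm. 6.1; [Miller2011LMS] Def. 1.1; route file `Theses/PrintX11a.lean` (item 19064); cell files of
seat p1 (p532019, p533431, p534028, p535822).
-/

set_option autoImplicit false

noncomputable section

open scoped Classical

open WeierstrassCurve Literature.NumberTheory.EllipticCurves
  Literature.NumberTheory.EllipticCurves.ModularForms
  Literature.NumberTheory.EllipticCurves.Rank1Residual
  Literature.NumberTheory.EllipticCurves.Rank1Residual.Typed
  Literature.NumberTheory.EllipticCurves.Wuthrich2014
  Literature.NumberTheory.EllipticCurves.SteinWuthrich2013
  Summit.BirchSwinnertonDyer.Rank1Residual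

namespace Summit.BirchSwinnertonDyer.BirchSwinnertonDyer.Theorems

/-- **Road p1 on the surjective sub-leaf of crux 19064, by name**: the Eisenstein half at every X11a
pair with `p ≥ 5` and `ρ̄_{E,p}` onto gives the lower half `ord_p #Ш_an ≤ ord_p #Ш` there (Kato–Wuthrich
A32 makes it Mazur's main conjecture; Stein–Wuthrich ×2 + Greenberg–Stevens + GZK + modularity descend
to `BSD(E,p)`; Miller's currency). [cite: Wuthrich2014, Thm. 3 and Cor. 19] [cite: SteinWuthrich2013, Thm. 6.1 (p. 20)]
[cite: Miller2011LMS, Def. 1.1] -/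
theorem x11aLowerHalf_onSurjFive_of_forall_eisensteinHalfAt (hNf : exists_isNewformOf)
    (hKato : kato_charIdeal_dvd_multiplicative_of_surjective)
    (hJs : thm61_splitMultiplicative) (hJn : thm61_nonsplitMultiplicative)
    (hGZK : rank_eq_analyticRank_of_analyticRank_le_one)
    (hGS : ∀ (W : WeierstrassCurve ℚ) [W.IsElliptic] [W.IsGloballyMinimal] (p : ℕ) [Fact p.Prime],
      greenberg_stevens (W := W) (p := p))
    (hE : ∀ (W : WeierstrassCurve ℚ) [W.IsElliptic] [W.IsGloballyMinimal] (p : ℕ) [Fact p.Prime],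
      ClassX11a W p → 5 ≤ p → Surj W p → X11a.EisensteinHalfAt W p) :
    ∀ (W : WeierstrassCurve ℚ) [W.IsElliptic] [W.IsGloballyMinimal] (p : ℕ) [Fact p.Prime],
      ClassX11a W p → 5 ≤ p → Surj W p → MissingLowerBoundAt W p :=
  fun W _ _ p _ hX hp hs =>
    X11a.missingLowerBoundAt_of_eisensteinHalf W p hNf hKato hJs hJn hGZK (hGS W p) hX hp hs
      (hE W p hX hp hs)

/-- **The same one step upstream**: the Hida-members transfer datum (Skinner 2016 §3.1 read
one-sidedly) at every such pair gives the lower half there. [cite: Skinner2016PacificMC, §3.1–3.3 (one-sided reading)]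
[cite: Wuthrich2014, Thm. 3 and Cor. 19] [cite: Miller2011LMS, Def. 1.1] -/
theorem x11aLowerHalf_onSurjFive_of_forall_hidaMembersTransferAt (hNf : exists_isNewformOf)
    (hKato : kato_charIdeal_dvd_multiplicative_of_surjective)
    (hJs : thm61_splitMultiplicative) (hJn : thm61_nonsplitMultiplicative)
    (hGZK : rank_eq_analyticRank_of_analyticRank_le_one)
    (hGS : ∀ (W : WeierstrassCurve ℚ) [W.IsElliptic] [W.IsGloballyMinimal] (p : ℕ) [Fact p.Prime],
      greenberg_stevens (W := W) (p := p))
    (hH : ∀ (W : WeierstrassCurve ℚ) [W.IsElliptic] [W.IsGloballyMinimal] (p : ℕ) [Fact p.Prime],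
      ClassX11a W p → 5 ≤ p → Surj W p → X11a.HidaMembersTransferAt W p) :
    ∀ (W : WeierstrassCurve ℚ) [W.IsElliptic] [W.IsGloballyMinimal] (p : ℕ) [Fact p.Prime],
      ClassX11a W p → 5 ≤ p → Surj W p → MissingLowerBoundAt W p :=
  fun W _ _ p _ hX hp hs =>
    X11a.missingLowerBoundAt_of_hidaMembersTransferAt W p hNf hKato hJs hJn hGZK (hGS W p) hX hp hs
      (hH W p hX hp hs)

/-- **The statement of crux `X11aLowerHalf` (verbatim body) from its three sub-leaves** (pure logic: an X11a prime is `3` or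
`≥ 5`, and at `p ≥ 5` the image is onto or not): the surjective sub-leaf at `p ≥ 5` (roads p1 / p2 /
p4 of the cell), the `p = 3` sub-cell (`X11a.CellThree`, x11b/x11c's domain), and the non-surjective
sub-leaf at `p ≥ 5` (rung K6). [cite: Miller2011LMS, Def. 1.1] -/
theorem x11aLowerHalf_of_subleaves
    (h5s : ∀ (W : WeierstrassCurve ℚ) [W.IsElliptic] [W.IsGloballyMinimal] (p : ℕ) [Fact p.Prime],
      ClassX11a W p → 5 ≤ p → Surj W p → MissingLowerBoundAt W p)
    (h3 : ∀ (W : WeierstrassCurve ℚ) [W.IsElliptic] [W.IsGloballyMinimal] (p : ℕ) [Fact p.Prime],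
      ClassX11a W p → p = 3 → MissingLowerBoundAt W p)
    (h5n : ∀ (W : WeierstrassCurve ℚ) [W.IsElliptic] [W.IsGloballyMinimal] (p : ℕ) [Fact p.Prime],
      ClassX11a W p → 5 ≤ p → ¬ Surj W p → MissingLowerBoundAt W p) :
    ∀ (Wd : WeierstrassCurve ℚ) [Wd.IsElliptic] [Wd.IsGloballyMinimal] (p : ℕ) [Fact p.Prime],
      ClassX11a Wd p → MissingLowerBoundAt Wd p := by
  intro W _ _ p _ hX
  by_cases hp3 : p = 3
  · exact h3 W p hX hp3
  · have hp5 : 5 ≤ p := (Fact.out : p.Prime).five_le_of_ne_two_of_ne_three hX.ne_two hp3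
    by_cases hs : Surj W p
    · exact h5s W p hX hp5 hs
    · exact h5n W p hX hp5 hs

/-- **The statement of crux `X11aLowerHalf` from road p1's input on the surjective sub-leaf** plus the two other sub-leaf
statements: `X11aLowerHalf` ⟸ (Eisenstein half at every X11a pair with `p ≥ 5`, `ρ̄` onto) ∧
(lower half on `CellThree`) ∧ (lower half at `p ≥ 5`, `ρ̄` not onto), granted the PUBLISHED A32,
Stein–Wuthrich ×2, Greenberg–Stevens, GZK, modularity. [cite: Skinner2016PacificMC, §3.1–3.3 (shape)]
[cite: Wuthrich2014, Thm. 3 and Cor. 19] [cite: Miller2011LMS, Def. 1.1] -/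
theorem x11aLowerHalf_of_forall_eisensteinHalfAt_of_three_of_nonSurj (hNf : exists_isNewformOf)
    (hKato : kato_charIdeal_dvd_multiplicative_of_surjective)
    (hJs : thm61_splitMultiplicative) (hJn : thm61_nonsplitMultiplicative)
    (hGZK : rank_eq_analyticRank_of_analyticRank_le_one)
    (hGS : ∀ (W : WeierstrassCurve ℚ) [W.IsElliptic] [W.IsGloballyMinimal] (p : ℕ) [Fact p.Prime],
      greenberg_stevens (W := W) (p := p))
    (hE : ∀ (W : WeierstrassCurve ℚ) [W.IsElliptic] [W.IsGloballyMinimal] (p : ℕ) [Fact p.Prime],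
      ClassX11a W p → 5 ≤ p → Surj W p → X11a.EisensteinHalfAt W p)
    (h3 : ∀ (W : WeierstrassCurve ℚ) [W.IsElliptic] [W.IsGloballyMinimal] (p : ℕ) [Fact p.Prime],
      ClassX11a W p → p = 3 → MissingLowerBoundAt W p)
    (h5n : ∀ (W : WeierstrassCurve ℚ) [W.IsElliptic] [W.IsGloballyMinimal] (p : ℕ) [Fact p.Prime],
      ClassX11a W p → 5 ≤ p → ¬ Surj W p → MissingLowerBoundAt W p) :
    ∀ (Wd : WeierstrassCurve ℚ) [Wd.IsElliptic] [Wd.IsGloballyMinimal] (p : ℕ) [Fact p.Prime],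
      ClassX11a Wd p → MissingLowerBoundAt Wd p :=
  x11aLowerHalf_of_subleaves
    (x11aLowerHalf_onSurjFive_of_forall_eisensteinHalfAt hNf hKato hJs hJn hGZK hGS hE) h3 h5n

/-! ### Appendix (seat p1, generation 2): the BASE-CHANGE socket of road p1 reaches the crux's
surjective sub-leaf BY NAME

Road p1's second typed input — the Burungale–Castella–Skinner four-factor display at `p ‖ N`,
`X11a.BaseChangeLowerBoundAt W p` (`Rank1Residual/X11a/BaseChangeRoute.lean`, b2b gen 23: THE
integral (5.3)-shaped lower bound for `E` and its three quadratic twists by `d_K`, `d_F`, `d_K d_F`,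
fields UNRAMIFIED at every `ℓ ∣ N`, so NO (ram) prime is acquired) — delivers the lower half
`Typed.MissingLowerBoundAt W p` on `ClassX11a ∧ 5 ≤ p ∧ Surj` with NO appeal to `EisensteinHalfAt`,
through `X11a.bsdp_of_baseChangeLowerBound` (Kato–Wuthrich A32 for the four curves +
`isUnit_of_prod_mem_span`; then Stein–Wuthrich ×2, Greenberg–Stevens, GZK, modularity). The input is
needed only on the LEAF pairs (`X11a.Leaf W p`: `p ∣ #Ш_an` or `ρ̄` not onto): the unit cells
`X11a.CellPub` are closed by Wuthrich 2014 Prop. 21 (`X11a.CellPub.bsdp`). STATUS of the input: OPEN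
at `p ‖ N` — printed twin = BCS Prop. 5.2.1 + (5.3) at GOOD ordinary `p` (arXiv:2405.00270v2 pp. 9–10);
missing in print at a multiplicative prime: the Steinberg specialisation of Wan's family divisibility
and the weight-two zeta-element integrality step (BCS Thm. 4.1.3, `p ∤ 2N`). «beyond-print theorem:
this appendix NO (glue); a closure on this socket: YES». Nothing booked; no label change. -/

/-- **Road p1, base-change socket, on the surjective sub-leaf of crux 19064 (by name)**: the BCS
four-factor display at every X11a pair with `p ≥ 5` and `ρ̄_{E,p}` onto gives the lower half
`ord_p #Ш_an ≤ ord_p #Ш` there (`X11a.bsdp_of_baseChangeLowerBound`; `Ш` finite by GZK;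
`Typed.missingPPartAt_of_bsdp`). PUBLISHED facts: A32 `hKato`, Stein–Wuthrich Thm. 6.1 ×2,
Greenberg–Stevens, GZK, modularity `hNf`. [cite: BurungaleCastellaSkinner2025, display (5.3) and "Proof of Theorem 1.1.2" (arXiv:2405.00270v2 p. 10) (shape only)]
[cite: Wuthrich2014, Thm. 3 and Cor. 19] [cite: SteinWuthrich2013, Thm. 6.1 (p. 20)] [cite: Miller2011LMS, Def. 1.1] -/
theorem x11aLowerHalf_onSurjFive_of_forall_baseChangeLowerBoundAt (hNf : exists_isNewformOf)
    (hKato : kato_charIdeal_dvd_multiplicative_of_surjective)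
    (hJs : thm61_splitMultiplicative) (hJn : thm61_nonsplitMultiplicative)
    (hGZK : rank_eq_analyticRank_of_analyticRank_le_one)
    (hGS : ∀ (W : WeierstrassCurve ℚ) [W.IsElliptic] [W.IsGloballyMinimal] (p : ℕ) [Fact p.Prime],
      greenberg_stevens (W := W) (p := p))
    (hBC : ∀ (W : WeierstrassCurve ℚ) [W.IsElliptic] [W.IsGloballyMinimal] (p : ℕ) [Fact p.Prime],
      ClassX11a W p → 5 ≤ p → Surj W p → X11a.BaseChangeLowerBoundAt W p) :
    ∀ (W : WeierstrassCurve ℚ) [W.IsElliptic] [W.IsGloballyMinimal] (p : ℕ) [Fact p.Prime],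
      ClassX11a W p → 5 ≤ p → Surj W p → MissingLowerBoundAt W p := by
  intro W _ _ p _ hX hp hs
  haveI : Finite W.sha := (hGZK W (by rw [hX.analyticRank_eq_zero]; exact zero_le_one)).2
  exact (lower_and_upper_of_missingPPartAt W p (missingPPartAt_of_bsdp W p
    (X11a.bsdp_of_baseChangeLowerBound W p hNf hKato hJs hJn hGZK (hGS W p) hX hp hs
      (hBC W p hX hp hs)))).1

/-- **The same with the input asked only on the LEAF** (`X11a.Leaf W p ∧ Surj W p`, i.e. `p ≥ 5`,
`ρ̄` onto and `p ∣ #Ш_an`): on the unit cells `X11a.CellPub` (`p ∤ #Ш_an`) the lower half is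
PRINTED — Wuthrich 2014 Prop. 21 (`hWu`), GZK, modularity (`X11a.CellPub.bsdp`) — so the base-change
display is consumed exactly where something is missing. This is the hypothesis shape of the tree's
`X11a.targetLeafSurj_of_forall_baseChangeLowerBound`, now landed in crux 19064's currency.
[cite: Wuthrich2014, Prop. 21 (p. 400)] [cite: BurungaleCastellaSkinner2025, display (5.3) (arXiv:2405.00270v2 p. 10) (shape only)]
[cite: Miller2011LMS, Def. 1.1] -/
theorem x11aLowerHalf_onSurjFive_of_forall_leaf_baseChangeLowerBoundAt (hNf : exists_isNewformOf)
    (hWu : sha_dvd_analyticSha)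
    (hKato : kato_charIdeal_dvd_multiplicative_of_surjective)
    (hJs : thm61_splitMultiplicative) (hJn : thm61_nonsplitMultiplicative)
    (hGZK : rank_eq_analyticRank_of_analyticRank_le_one)
    (hGS : ∀ (W : WeierstrassCurve ℚ) [W.IsElliptic] [W.IsGloballyMinimal] (p : ℕ) [Fact p.Prime],
      greenberg_stevens (W := W) (p := p))
    (hBC : ∀ (W : WeierstrassCurve ℚ) [W.IsElliptic] [W.IsGloballyMinimal] (p : ℕ) [Fact p.Prime],
      X11a.Leaf W p → Surj W p → X11a.BaseChangeLowerBoundAt W p) :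
    ∀ (W : WeierstrassCurve ℚ) [W.IsElliptic] [W.IsGloballyMinimal] (p : ℕ) [Fact p.Prime],
      ClassX11a W p → 5 ≤ p → Surj W p → MissingLowerBoundAt W p := by
  intro W _ _ p _ hX hp hs
  haveI : Finite W.sha := (hGZK W (by rw [hX.analyticRank_eq_zero]; exact zero_le_one)).2
  refine (lower_and_upper_of_missingPPartAt W p (missingPPartAt_of_bsdp W p ?_)).1
  by_cases hu : X11a.ShaAnUnit W p
  · exact X11a.CellPub.bsdp hWu hGZK (hasEntireLFunction_rat_of_exists_isNewformOf hNf)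
      ⟨hX, hp, hs, hu⟩
  · have hL : X11a.Leaf W p := ⟨hX, hp, fun h => hu h.2⟩
    exact X11a.bsdp_of_baseChangeLowerBound W p hNf hKato hJs hJn hGZK (hGS W p) hX hp hs
      (hBC W p hL hs)

/-- **The statement of crux `X11aLowerHalf` (verbatim body) from road p1's BASE-CHANGE input on the
surjective leaf** plus the two other sub-leaf statements (`p = 3`; `p ≥ 5`, `ρ̄` not onto), granted
the PUBLISHED Wuthrich Prop. 21, A32, Stein–Wuthrich ×2, Greenberg–Stevens, GZK, modularity
(`x11aLowerHalf_of_subleaves`). [cite: BurungaleCastellaSkinner2025, display (5.3) (arXiv:2405.00270v2 p. 10) (shape only)]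
[cite: Wuthrich2014, Prop. 21, Thm. 3 and Cor. 19] [cite: Miller2011LMS, Def. 1.1] -/
theorem x11aLowerHalf_of_forall_leaf_baseChangeLowerBoundAt_of_three_of_nonSurj
    (hNf : exists_isNewformOf) (hWu : sha_dvd_analyticSha)
    (hKato : kato_charIdeal_dvd_multiplicative_of_surjective)
    (hJs : thm61_splitMultiplicative) (hJn : thm61_nonsplitMultiplicative)
    (hGZK : rank_eq_analyticRank_of_analyticRank_le_one)
    (hGS : ∀ (W : WeierstrassCurve ℚ) [W.IsElliptic] [W.IsGloballyMinimal] (p : ℕ) [Fact p.Prime],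
      greenberg_stevens (W := W) (p := p))
    (hBC : ∀ (W : WeierstrassCurve ℚ) [W.IsElliptic] [W.IsGloballyMinimal] (p : ℕ) [Fact p.Prime],
      X11a.Leaf W p → Surj W p → X11a.BaseChangeLowerBoundAt W p)
    (h3 : ∀ (W : WeierstrassCurve ℚ) [W.IsElliptic] [W.IsGloballyMinimal] (p : ℕ) [Fact p.Prime],
      ClassX11a W p → p = 3 → MissingLowerBoundAt W p)
    (h5n : ∀ (W : WeierstrassCurve ℚ) [W.IsElliptic] [W.IsGloballyMinimal] (p : ℕ) [Fact p.Prime],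
      ClassX11a W p → 5 ≤ p → ¬ Surj W p → MissingLowerBoundAt W p) :
    ∀ (Wd : WeierstrassCurve ℚ) [Wd.IsElliptic] [Wd.IsGloballyMinimal] (p : ℕ) [Fact p.Prime],
      ClassX11a Wd p → MissingLowerBoundAt Wd p :=
  x11aLowerHalf_of_subleaves
    (x11aLowerHalf_onSurjFive_of_forall_leaf_baseChangeLowerBoundAt hNf hWu hKato hJs hJn hGZK hGS hBC)
    h3 h5n

end Summit.BirchSwinnertonDyer.BirchSwinnertonDyer.Theorems

end
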